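import Mathlib.MeasureTheory.Integral.Layercake
import Mathlib.Analysis.SpecialFunctions.Integrals.Basic
import Mathlib.Analysis.SpecialFunctions.ImproperIntegrals
import Mathlib.MeasureTheory.Integral.IntegrableOn

/-!
# Layer-cake (Cavalieri) bounds with power tails

Support file for the proof of the Jerrard–Seis energy lower bound
(`Literature.Analysis.FluidPDE.VortexFilament.JerrardSeis2016_filamentEnergyLowerBound`).
Generic measure theory: if `0 ≤ G ≤ T` on a finite measure space and the distribution function
`t ↦ μ{G > t}` is dominated on `(0, T)`, then `∫ G dμ` is bounded by the integral of the
dominating function (Mathlib's `MeasureTheory.lintegral_eq_lintegral_meas_lt`). Two concrete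
tails are evaluated: `c t^{-1/2}` (giving `2c√T`) and `min(M, c/t²)` (giving `2√(cM)`); these are
the shapes produced by Jerrard–Seis' Lemma 4 (`|{s : |γ(s) − x| < r}| ≲ rK`) when integrating
`|x − γ(s)|^{-2}`, `|x − γ(s)|^{-1}` and the distribution of the excess-energy integrand
along the curve [JerrardSeis2016, §4.1, §4.3].
-/

noncomputable section

open MeasureTheory Set Filter
open scoped ENNReal NNReal Topology

namespace Literature.Analysis.FluidPDE

namespace VortexFilament

/-- **Layer cake, bounded form.** If `0 ≤ G ≤ T`, and the distribution function of `G` is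
dominated on `(0, T)` by `b`, then `∫ G ≤ ∫_{(0,T)} b`. [folklore] -/
theorem integral_le_of_meas_lt_le {α : Type*} [MeasurableSpace α] {μ : Measure α}
    [IsFiniteMeasure μ] {G : α → ℝ} {T : ℝ} (hG0 : ∀ x, 0 ≤ G x) (hGT : ∀ x, G x ≤ T)
    (hGm : AEMeasurable G μ) (b : ℝ → ℝ≥0∞)
    (hb : ∀ t, 0 < t → t < T → μ {x | t < G x} ≤ b t) (hfin : ∫⁻ t in Ioo 0 T, b t ≠ ∞) :
    ∫ x, G x ∂μ ≤ (∫⁻ t in Ioo 0 T, b t).toReal := by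
  rw [integral_eq_lintegral_of_nonneg_ae (ae_of_all _ hG0) hGm.aestronglyMeasurable,
    lintegral_eq_lintegral_meas_lt μ (ae_of_all _ hG0) hGm]
  refine ENNReal.toReal_mono hfin ?_
  calc ∫⁻ t in Ioi 0, μ {x | t < G x}
      ≤ ∫⁻ t in Ioo 0 T ∪ Ici T, μ {x | t < G x} := by
        refine lintegral_mono_set fun t ht => ?_
        rcases lt_or_ge t T with h | h
        · exact Or.inl ⟨ht, h⟩
        · exact Or.inr h
    _ ≤ (∫⁻ t in Ioo 0 T, μ {x | t < G x}) + ∫⁻ t in Ici T, μ {x | t < G x} :=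
        lintegral_union_le _ _ _
    _ = (∫⁻ t in Ioo 0 T, μ {x | t < G x}) + 0 := by
        congr 1
        refine setLIntegral_eq_zero measurableSet_Ici fun t ht => ?_
        have : {x | t < G x} = ∅ := by
          ext x
          simp only [mem_setOf_eq, mem_empty_iff_false, iff_false, not_lt]
          exact (hGT x).trans ht
        simp [this]
    _ ≤ ∫⁻ t in Ioo 0 T, b t := by
        rw [add_zero]
        exact setLIntegral_mono' measurableSet_Ioo fun t ht => hb t ht.1 ht.2

/-- `∫_{(0,T)} c t^{-1/2} dt = 2 c √T` as a Lebesgue integral. [folklore] -/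
theorem lintegral_rpow_neg_half {c T : ℝ} (hc : 0 ≤ c) (hT : 0 < T) :
    ∫⁻ t in Ioo 0 T, ENNReal.ofReal (c * t ^ (-(1/2 : ℝ))) =
      ENNReal.ofReal (2 * c * Real.sqrt T) := by
  have hint : IntervalIntegrable (fun t : ℝ => t ^ (-(1/2 : ℝ))) volume 0 T :=
    intervalIntegral.intervalIntegrable_rpow' (by norm_num)
  have hint' : IntegrableOn (fun t : ℝ => c * t ^ (-(1/2 : ℝ))) (Ioo 0 T) volume := by
    have := (hint.1).const_mul c
    exact IntegrableOn.mono_set this Ioo_subset_Ioc_self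
  rw [← ofReal_integral_eq_lintegral_ofReal hint']
  · congr 1
    have h0 : ∫ t in Ioo 0 T, c * t ^ (-(1/2:ℝ)) = ∫ t in (0:ℝ)..T, c * t ^ (-(1/2:ℝ)) := by
      rw [intervalIntegral.integral_of_le hT.le, integral_Ioc_eq_integral_Ioo]
    rw [h0, intervalIntegral.integral_const_mul, integral_rpow (Or.inl (by norm_num))]
    have h1 : (-(1/2 : ℝ)) + 1 = 1/2 := by norm_num
    rw [h1, Real.zero_rpow (by norm_num), sub_zero, Real.sqrt_eq_rpow]
    ring
  · refine ae_restrict_of_forall_mem measurableSet_Ioo fun t ht => ?_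
    exact mul_nonneg hc (Real.rpow_nonneg ht.1.le _)

/-- **Layer cake with a `t^{-1/2}` tail.** If `0 ≤ G ≤ T` and `μ{G > t} ≤ c t^{-1/2}` for
`0 < t < T`, then `∫ G dμ ≤ 2 c √T`. [folklore] -/
theorem integral_le_of_meas_lt_le_rpow_neg_half {α : Type*} [MeasurableSpace α]
    {μ : Measure α} [IsFiniteMeasure μ] {G : α → ℝ} {T c : ℝ} (hc : 0 ≤ c) (hT : 0 < T)
    (hG0 : ∀ x, 0 ≤ G x) (hGT : ∀ x, G x ≤ T) (hGm : AEMeasurable G μ)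
    (hb : ∀ t, 0 < t → t < T → μ {x | t < G x} ≤ ENNReal.ofReal (c * t ^ (-(1/2 : ℝ)))) :
    ∫ x, G x ∂μ ≤ 2 * c * Real.sqrt T := by
  have h := integral_le_of_meas_lt_le hG0 hGT hGm (fun t => ENNReal.ofReal (c * t ^ (-(1/2 : ℝ))))
    hb (by rw [lintegral_rpow_neg_half hc hT]; exact ENNReal.ofReal_ne_top)
  rw [lintegral_rpow_neg_half hc hT, ENNReal.toReal_ofReal (by positivity)] at h
  exact h

/-- `∫_{(t₀, ∞)} c/t² dt = c/t₀` as a Lebesgue integral. [folklore] -/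
theorem lintegral_Ioi_div_sq {c t₀ : ℝ} (hc : 0 ≤ c) (ht₀ : 0 < t₀) :
    ∫⁻ t in Ioi t₀, ENNReal.ofReal (c / t ^ 2) = ENNReal.ofReal (c / t₀) := by
  have hint : IntegrableOn (fun t : ℝ => c * t ^ (-2 : ℝ)) (Ioi t₀) volume :=
    (integrableOn_Ioi_rpow_of_lt (by norm_num) ht₀).const_mul c
  have heq : ∀ t ∈ Ioi t₀, c / t ^ 2 = c * t ^ (-2 : ℝ) := by
    intro t ht
    have htpos : 0 < t := ht₀.trans ht
    rw [Real.rpow_neg htpos.le, div_eq_mul_inv]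
    norm_cast
  have hint' : IntegrableOn (fun t : ℝ => c / t ^ 2) (Ioi t₀) volume :=
    hint.congr_fun (fun t ht => (heq t ht).symm) measurableSet_Ioi
  rw [← ofReal_integral_eq_lintegral_ofReal hint']
  · congr 1
    rw [setIntegral_congr_fun measurableSet_Ioi heq, integral_const_mul,
      integral_Ioi_rpow_of_lt (by norm_num) ht₀]
    have h1 : (-2 : ℝ) + 1 = -1 := by norm_num
    rw [h1, Real.rpow_neg_one]
    field_simp
  · refine ae_restrict_of_forall_mem measurableSet_Ioi fun t ht => ?_
    have htpos : 0 < t := ht₀.trans ht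
    positivity

/-- **Layer cake with a `min(M, c/t²)` tail.** If `0 ≤ G ≤ T` and
`μ{G > t} ≤ min(M, c/t²)` for `0 < t < T`, then `∫ G dμ ≤ 2 √(c M)`. [folklore] -/
theorem integral_le_of_meas_lt_le_min_sq {α : Type*} [MeasurableSpace α]
    {μ : Measure α} [IsFiniteMeasure μ] {G : α → ℝ} {T c M : ℝ} (hc : 0 < c) (hM : 0 < M)
    (hG0 : ∀ x, 0 ≤ G x) (hGT : ∀ x, G x ≤ T) (hGm : AEMeasurable G μ)
    (hb : ∀ t, 0 < t → t < T → μ {x | t < G x} ≤ ENNReal.ofReal (min M (c / t ^ 2))) :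
    ∫ x, G x ∂μ ≤ 2 * Real.sqrt (c * M) := by
  set t₀ : ℝ := Real.sqrt (c / M) with ht₀
  have ht₀pos : 0 < t₀ := Real.sqrt_pos.2 (div_pos hc hM)
  have ht₀sq : t₀ ^ 2 = c / M := Real.sq_sqrt (div_pos hc hM).le
  have hMt₀ : M * t₀ = Real.sqrt (c * M) := by
    rw [ht₀, show c * M = M ^ 2 * (c / M) by field_simp, Real.sqrt_mul (by positivity),
      Real.sqrt_sq hM.le]
  have hct₀ : c / t₀ = Real.sqrt (c * M) := by
    rw [← hMt₀, div_eq_iff ht₀pos.ne', mul_assoc, ← sq, ht₀sq]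
    field_simp
  have hle : ∫⁻ t in Ioo 0 T, ENNReal.ofReal (min M (c / t ^ 2)) ≤
      ENNReal.ofReal (2 * Real.sqrt (c * M)) := by
    calc ∫⁻ t in Ioo 0 T, ENNReal.ofReal (min M (c / t ^ 2))
        ≤ ∫⁻ t in Ioc 0 t₀ ∪ Ioi t₀, ENNReal.ofReal (min M (c / t ^ 2)) := by
          refine lintegral_mono_set fun t ht => ?_
          rcases le_or_gt t t₀ with h | h
          · exact Or.inl ⟨ht.1, h⟩
          · exact Or.inr h
      _ ≤ (∫⁻ t in Ioc 0 t₀, ENNReal.ofReal (min M (c / t ^ 2))) +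
            ∫⁻ t in Ioi t₀, ENNReal.ofReal (min M (c / t ^ 2)) := lintegral_union_le _ _ _
      _ ≤ (∫⁻ t in Ioc 0 t₀, ENNReal.ofReal M) + ∫⁻ t in Ioi t₀, ENNReal.ofReal (c / t ^ 2) := by
          gcongr with t t
          · exact min_le_left _ _
          · exact min_le_right _ _
      _ = ENNReal.ofReal (M * t₀) + ENNReal.ofReal (c / t₀) := by
          rw [lintegral_Ioi_div_sq hc.le ht₀pos, setLIntegral_const, Real.volume_Ioc, sub_zero,
            ← ENNReal.ofReal_mul hM.le]
      _ = ENNReal.ofReal (2 * Real.sqrt (c * M)) := by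
          rw [← ENNReal.ofReal_add (by positivity) (by positivity), hMt₀, hct₀]; ring_nf
  have h := integral_le_of_meas_lt_le hG0 hGT hGm (fun t => ENNReal.ofReal (min M (c / t ^ 2)))
    hb (ne_top_of_le_ne_top ENNReal.ofReal_ne_top hle)
  exact h.trans ((ENNReal.toReal_mono ENNReal.ofReal_ne_top hle).trans_eq
    (ENNReal.toReal_ofReal (by positivity)))

end VortexFilament

end Literature.Analysis.FluidPDE
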